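import Summits.CriticalPhenomena.PercolationContinuityZ3.Theorems.Transplant.FKConnectivityAllQClusterDomAssoc
import Summits.CriticalPhenomena.PercolationContinuityZ3.Theorems.Transplant.FKConnectivityAllQGluing
import HarnessLib

/-!
# Connectivity correlation inequalities for `φ_{w,q}`, every `q > 0` — CONDITIONAL cluster monotonicity in an adjacent edge:
# DEFINITIONS (two conjecture nodes), the algebra of the conditioned Harris step, transport lemmas

Definitions file (`--supports stmt-CriticalPhenomena-4575`), FK sub-lane `prim-bschramm-fk-1` (gen 8) of the post-continuity
programme; builds on p205010 (kernel theorem, internal audit signed; external expert review pending).  Definitions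
(`CondClusterDomAdjOn/FK`, `CrossClusterAntiAdjOn/FK`, two `@[conjecture]` nodes — NOT asserted), no named facts, no sorries;
standard axioms.  The theorems (MMc⁺ ⇒ `HubCondUnder`, MMc⁺ ∧ MMc⁻ ⇒ `TwoArmNegUnder`, node implications) are in the companion
`…CondClusterDom.lean`.

The companion file `…ClusterDomAssoc` proves MM ⇒ CA by Harris' induction on the pairs at the cluster.  The same induction run
under the conditioning `{x ↮ c}` needs two monotonicity inputs, recorded here as conjecture nodes (exact census fk-1 g8: 0 violations,
all up-sets, random weighted graphs on `≤ 6` vertices, `q ∈ {1/10, 1/2, 9/10, 1, 3/2, 2, 3}`):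
* (MMc⁺, `CondClusterDomAdjOn`) for a pair `f = xz` at `x` and a third vertex `c`, the law of `C_x` GIVEN `{x ↮ c}` is stochastically
  larger when `f` is open than when `f` is closed:
  `φ_{w[f↦0]}(C_x ∈ 𝒰, x ↮ c)·φ_{w[f↦1]}(x ↮ c) ≤ φ_{w[f↦1]}(C_x ∈ 𝒰, x ↮ c)·φ_{w[f↦0]}(x ↮ c)`;
* (MMc⁻, `CrossClusterAntiAdjOn`) under the same conditioning the law of the OTHER cluster `C_c` is stochastically smaller when `f` is
  open: `φ_{w[f↦1]}(C_c ∈ 𝒱, x ↮ c)·φ_{w[f↦0]}(x ↮ c) ≤ φ_{w[f↦0]}(C_c ∈ 𝒱, x ↮ c)·φ_{w[f↦1]}(x ↮ c)`.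
THEOREMS (every `q > 0`, Harris' induction under conditioning; the cross term is `(d₁a₀ − d₀a₁)(d₁b₀ − d₀b₁)` with the signs of the
two brackets supplied by the nodes): `hubCondUnder_of_condClusterDomAdjOn` (MMc⁺ ⇒ vdBHK Thm 1.3-shape `HubCondUnder` for `φ_{w,q}`),
`twoArmNegUnder_of_cond` (MMc⁺ ∧ MMc⁻ ⇒ vdBHK Thm 1.4-shape `TwoArmNegUnder`); with fk-1 g4's `fourPointFKPos_of` and
`additiveGluingTwoFKPos_of`: `CondClusterDomAdjFKPos ∧ CrossClusterAntiAdjFKPos → FourPointFKPos → AdditiveGluingTwoFKPos` — the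
`|A| ≤ 2` slice of Kozma–Nitzan additive gluing for every `q ∈ (0,1)` from two single-edge monotonicity statements.
At `q = 1` both nodes follow from van den Berg–Kahn's one-cluster conditional association and the Markov property (memo
bschramm/FROM-fk-1-g8-*.md §2); they are recorded for all `q > 0` and NOT asserted.
[cite: VandenbergHaggstromKahn2005, Thms. 1.3, 1.4 (pp. 6–7)] [cite: KozmaNitzan2024, Thm. 1, proof (pp. 7–8); Conj. 1 (p. 3)]
[cite: Grimmett2006, Thm. (2.19) proof (pp. 26–27); Thm. (3.7) (p. 39); §3.9 (pp. 63–65)]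
-/

noncomputable section

namespace Summit.CriticalPhenomena.PercolationContinuityZ3.Theorems

namespace FK

open MeasureTheory Set Literature.Probability.LatticeModels Literature.Probability.Percolation
open scoped Classical
open BHK2006 DecisionTree HullPort

variable {V : Type*} [Fintype V]

/-! ### The two conditional monotonicity statements -/

/-- **MMc⁺ — conditional cluster dominance across an adjacent edge on the vertex type `V`**: for all weights `w`, vertices `x, z, c`
and up-sets `𝒰`, `φ_{w[xz↦0]}(C_x ∈ 𝒰, x ↮ c)·φ_{w[xz↦1]}(x ↮ c) ≤ φ_{w[xz↦1]}(C_x ∈ 𝒰, x ↮ c)·φ_{w[xz↦0]}(x ↮ c)` (the law of `C_x`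
given `{x ↮ c}` is stochastically increasing in the state of `xz`).  Conjectural for every `q > 0`; at `q = 1` a consequence of
one-cluster conditional association. [cite: VandenbergHaggstromKahn2005, Thm. 1.3 (p. 6)] [cite: Grimmett2006, §3.9 (p. 63)] -/
def CondClusterDomAdjOn (V : Type*) [Fintype V] (q : ℝ) : Prop :=
  ∀ (w : Sym2 V → unitInterval) (x z c : V) (𝒰 : Set (Set V)), IsUpperSet 𝒰 →
    (rcMeasureW (Function.update w s(x, z) 0) q ∅).real (clusterIn x 𝒰 ∩ sepEv x c) *
        (rcMeasureW (Function.update w s(x, z) 1) q ∅).real (sepEv x c) ≤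
      (rcMeasureW (Function.update w s(x, z) 1) q ∅).real (clusterIn x 𝒰 ∩ sepEv x c) *
        (rcMeasureW (Function.update w s(x, z) 0) q ∅).real (sepEv x c)

/-- **MMc⁻ — conditional cross-cluster anti-monotonicity on `V`**: for all `w, x, z, c` and up-sets `𝒱`,
`φ_{w[xz↦1]}(C_c ∈ 𝒱, x ↮ c)·φ_{w[xz↦0]}(x ↮ c) ≤ φ_{w[xz↦0]}(C_c ∈ 𝒱, x ↮ c)·φ_{w[xz↦1]}(x ↮ c)` (given `{x ↮ c}`, the law of
`C_c` is stochastically decreasing in the state of a pair at `x`).  Conjectural for every `q > 0`; at `q = 1` a consequence of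
one-cluster conditional association and the Markov property. [cite: VandenbergHaggstromKahn2005, Thm. 1.4 (p. 7)] [cite: Grimmett2006, §3.9 (p. 63)] -/
def CrossClusterAntiAdjOn (V : Type*) [Fintype V] (q : ℝ) : Prop :=
  ∀ (w : Sym2 V → unitInterval) (x z c : V) (𝒱 : Set (Set V)), IsUpperSet 𝒱 →
    (rcMeasureW (Function.update w s(x, z) 1) q ∅).real (clusterIn c 𝒱 ∩ sepEv x c) *
        (rcMeasureW (Function.update w s(x, z) 0) q ∅).real (sepEv x c) ≤
      (rcMeasureW (Function.update w s(x, z) 0) q ∅).real (clusterIn c 𝒱 ∩ sepEv x c) *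
        (rcMeasureW (Function.update w s(x, z) 1) q ∅).real (sepEv x c)

/-- MMc⁺ on every `Fin n`. [cite: VandenbergHaggstromKahn2005, Thm. 1.3 (p. 6)] -/
def CondClusterDomAdjFK (q : ℝ) : Prop := ∀ n : ℕ, CondClusterDomAdjOn (Fin n) q

/-- MMc⁻ on every `Fin n`. [cite: VandenbergHaggstromKahn2005, Thm. 1.4 (p. 7)] -/
def CrossClusterAntiAdjFK (q : ℝ) : Prop := ∀ n : ℕ, CrossClusterAntiAdjOn (Fin n) q

/-- **MMc⁺ for every `q > 0`.**  CONJECTURE-SHAPED STATEMENT, NOT asserted.  Evidence (fk-1 g8, 2026-08-21, exact rational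
arithmetic, all up-sets): random weighted graphs on `≤ 6` vertices, `q ∈ {1/10, 1/2, 9/10, 1, 3/2, 2, 3}`: 0 violations (memo
bschramm/FROM-fk-1-g8-*.md). [cite: VandenbergHaggstromKahn2005, Thm. 1.3 (p. 6)] [cite: Grimmett2006, §3.9 (pp. 63–65)] -/
@[conjecture] def CondClusterDomAdjFKPos : Prop := ∀ q : ℝ, 0 < q → CondClusterDomAdjFK q

/-- **MMc⁻ for every `q > 0`.**  CONJECTURE-SHAPED STATEMENT, NOT asserted.  Evidence as for `CondClusterDomAdjFKPos`.
[cite: VandenbergHaggstromKahn2005, Thm. 1.4 (p. 7)] [cite: Grimmett2006, §3.9 (pp. 63–65)] -/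
@[conjecture] def CrossClusterAntiAdjFKPos : Prop := ∀ q : ℝ, 0 < q → CrossClusterAntiAdjFK q

/-! ### Algebra of the conditioned induction step -/

/-- Cross-term inequality, positive version: from `aᵢbᵢ ≤ dᵢcᵢ`, `aᵢ, bᵢ ≤ dᵢ` and the MMc⁺ signs `d₁a₀ ≤ d₀a₁`, `d₁b₀ ≤ d₀b₁`:
`a₁b₀ + a₀b₁ ≤ d₁c₀ + d₀c₁`. [folklore] -/
theorem cross_le {a₁ a₀ b₁ b₀ c₁ c₀ d₁ d₀ : ℝ} (ha₀ : 0 ≤ a₀) (hb₀ : 0 ≤ b₀) (ha₁ : 0 ≤ a₁) (hb₁ : 0 ≤ b₁)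
    (hc₀ : 0 ≤ c₀) (hc₁ : 0 ≤ c₁)
    (had₀ : a₀ ≤ d₀) (hbd₀ : b₀ ≤ d₀) (had₁ : a₁ ≤ d₁) (hbd₁ : b₁ ≤ d₁)
    (h₁ : a₁ * b₁ ≤ d₁ * c₁) (h₀ : a₀ * b₀ ≤ d₀ * c₀) (ma : d₁ * a₀ ≤ d₀ * a₁) (mb : d₁ * b₀ ≤ d₀ * b₁) :
    a₁ * b₀ + a₀ * b₁ ≤ d₁ * c₀ + d₀ * c₁ := by
  have hd₀ : 0 ≤ d₀ := ha₀.trans had₀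
  have hd₁ : 0 ≤ d₁ := ha₁.trans had₁
  rcases hd₀.eq_or_lt with h0 | hpos0
  · -- `d₀ = 0`: then `a₀ = b₀ = 0`
    have ea : a₀ = 0 := le_antisymm (h0 ▸ had₀) ha₀
    have eb : b₀ = 0 := le_antisymm (h0 ▸ hbd₀) hb₀
    rw [ea, eb, ← h0]; nlinarith [mul_nonneg hd₁ hc₀]
  rcases hd₁.eq_or_lt with h1 | hpos1
  · have ea : a₁ = 0 := le_antisymm (h1 ▸ had₁) ha₁
    have eb : b₁ = 0 := le_antisymm (h1 ▸ hbd₁) hb₁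
    rw [ea, eb, ← h1]; nlinarith [mul_nonneg hd₀ hc₁]
  -- both positive: multiply by `d₀d₁`
  have key : d₀ * d₁ * (a₁ * b₀ + a₀ * b₁) ≤ d₀ * d₁ * (d₁ * c₀ + d₀ * c₁) := by
    have sq : 0 ≤ (d₀ * a₁ - d₁ * a₀) * (d₀ * b₁ - d₁ * b₀) :=
      mul_nonneg (sub_nonneg.2 ma) (sub_nonneg.2 mb)
    nlinarith [mul_le_mul_of_nonneg_left h₀ (mul_nonneg hd₁ hd₁), mul_le_mul_of_nonneg_left h₁ (mul_nonneg hd₀ hd₀), sq]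
  exact le_of_mul_le_mul_left key (mul_pos hpos0 hpos1)

/-- Cross-term inequality, negative version: from `dᵢcᵢ ≤ aᵢbᵢ`, `cᵢ ≤ aᵢ, cᵢ ≤ bᵢ`... (only `aᵢ, bᵢ ≤ dᵢ` and nonnegativity are
needed) and the signs `d₁a₀ ≤ d₀a₁` (MMc⁺), `d₀b₁ ≤ d₁b₀` (MMc⁻): `d₁c₀ + d₀c₁ ≤ a₁b₀ + a₀b₁`. [folklore] -/
theorem cross_ge {a₁ a₀ b₁ b₀ c₁ c₀ d₁ d₀ : ℝ} (ha₀ : 0 ≤ a₀) (hb₀ : 0 ≤ b₀) (ha₁ : 0 ≤ a₁) (hb₁ : 0 ≤ b₁)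
    (hc₀ : 0 ≤ c₀) (hc₁ : 0 ≤ c₁) (hcd₀ : c₀ ≤ d₀) (hcd₁ : c₁ ≤ d₁)
    (had₀ : a₀ ≤ d₀) (had₁ : a₁ ≤ d₁)
    (h₁ : d₁ * c₁ ≤ a₁ * b₁) (h₀ : d₀ * c₀ ≤ a₀ * b₀) (ma : d₁ * a₀ ≤ d₀ * a₁) (mb : d₀ * b₁ ≤ d₁ * b₀) :
    d₁ * c₀ + d₀ * c₁ ≤ a₁ * b₀ + a₀ * b₁ := by
  have hd₀ : 0 ≤ d₀ := ha₀.trans had₀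
  have hd₁ : 0 ≤ d₁ := ha₁.trans had₁
  rcases hd₀.eq_or_lt with h0 | hpos0
  · have ea : a₀ = 0 := le_antisymm (h0 ▸ had₀) ha₀
    have ec : c₀ = 0 := le_antisymm (h0 ▸ hcd₀) hc₀
    rw [ea, ec, ← h0]; nlinarith [mul_nonneg ha₁ hb₀]
  rcases hd₁.eq_or_lt with h1 | hpos1
  · have ea : a₁ = 0 := le_antisymm (h1 ▸ had₁) ha₁
    have ec : c₁ = 0 := le_antisymm (h1 ▸ hcd₁) hc₁
    rw [ea, ec, ← h1]; nlinarith [mul_nonneg ha₀ hb₁]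
  have key : d₀ * d₁ * (d₁ * c₀ + d₀ * c₁) ≤ d₀ * d₁ * (a₁ * b₀ + a₀ * b₁) := by
    have sq : (d₀ * a₁ - d₁ * a₀) * (d₀ * b₁ - d₁ * b₀) ≤ 0 :=
      mul_nonpos_of_nonneg_of_nonpos (sub_nonneg.2 ma) (sub_nonpos.2 mb)
    nlinarith [mul_le_mul_of_nonneg_left h₀ (mul_nonneg hd₁ hd₁), mul_le_mul_of_nonneg_left h₁ (mul_nonneg hd₀ hd₀), sq]
  exact le_of_mul_le_mul_left key (mul_pos hpos0 hpos1)

/-- The conditioned Harris step, positive version. [cite: Grimmett2006, Thm. (2.19) proof (pp. 26–27)] -/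
theorem cond_assoc_step {l a₁ a₀ b₁ b₀ c₁ c₀ d₁ d₀ : ℝ} (hl0 : 0 ≤ l) (hl1 : l ≤ 1)
    (ha₀ : 0 ≤ a₀) (hb₀ : 0 ≤ b₀) (ha₁ : 0 ≤ a₁) (hb₁ : 0 ≤ b₁) (hc₀ : 0 ≤ c₀) (hc₁ : 0 ≤ c₁)
    (had₀ : a₀ ≤ d₀) (hbd₀ : b₀ ≤ d₀) (had₁ : a₁ ≤ d₁) (hbd₁ : b₁ ≤ d₁)
    (h₁ : a₁ * b₁ ≤ d₁ * c₁) (h₀ : a₀ * b₀ ≤ d₀ * c₀) (ma : d₁ * a₀ ≤ d₀ * a₁) (mb : d₁ * b₀ ≤ d₀ * b₁) :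
    (l * a₁ + (1 - l) * a₀) * (l * b₁ + (1 - l) * b₀) ≤ (l * d₁ + (1 - l) * d₀) * (l * c₁ + (1 - l) * c₀) := by
  have cr := cross_le ha₀ hb₀ ha₁ hb₁ hc₀ hc₁ had₀ hbd₀ had₁ hbd₁ h₁ h₀ ma mb
  have hl' : 0 ≤ 1 - l := sub_nonneg.2 hl1
  nlinarith [mul_le_mul_of_nonneg_left h₁ (mul_nonneg hl0 hl0), mul_le_mul_of_nonneg_left h₀ (mul_nonneg hl' hl'),
    mul_le_mul_of_nonneg_left cr (mul_nonneg hl0 hl')]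

/-- The conditioned Harris step, negative version. [cite: Grimmett2006, Thm. (2.19) proof (pp. 26–27)] -/
theorem cond_neg_step {l a₁ a₀ b₁ b₀ c₁ c₀ d₁ d₀ : ℝ} (hl0 : 0 ≤ l) (hl1 : l ≤ 1)
    (ha₀ : 0 ≤ a₀) (hb₀ : 0 ≤ b₀) (ha₁ : 0 ≤ a₁) (hb₁ : 0 ≤ b₁) (hc₀ : 0 ≤ c₀) (hc₁ : 0 ≤ c₁)
    (hcd₀ : c₀ ≤ d₀) (hcd₁ : c₁ ≤ d₁) (had₀ : a₀ ≤ d₀) (had₁ : a₁ ≤ d₁)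
    (h₁ : d₁ * c₁ ≤ a₁ * b₁) (h₀ : d₀ * c₀ ≤ a₀ * b₀) (ma : d₁ * a₀ ≤ d₀ * a₁) (mb : d₀ * b₁ ≤ d₁ * b₀) :
    (l * d₁ + (1 - l) * d₀) * (l * c₁ + (1 - l) * c₀) ≤ (l * a₁ + (1 - l) * a₀) * (l * b₁ + (1 - l) * b₀) := by
  have cr := cross_ge ha₀ hb₀ ha₁ hb₁ hc₀ hc₁ hcd₀ hcd₁ had₀ had₁ h₁ h₀ ma mb
  have hl' : 0 ≤ 1 - l := sub_nonneg.2 hl1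
  nlinarith [mul_le_mul_of_nonneg_left h₁ (mul_nonneg hl0 hl0), mul_le_mul_of_nonneg_left h₀ (mul_nonneg hl' hl'),
    mul_le_mul_of_nonneg_left cr (mul_nonneg hl0 hl')]

/-! ### Transport along the weight-1 cluster and the deterministic base case -/

/-- On the support of `φ_u`, `{x ↮ c} = {v ↮ c}` when `x`, `v` are joined by parameter-1 pairs. [cite: Grimmett2006, §1.4 eq. (1.20) (p. 15)] -/
theorem ind_sepEv_eq_of_oneSet_reachable (u : Sym2 V → unitInterval) (q : ℝ) {x v : V}
    (hxv : (openGraph (oneSet u)).Reachable x v) (c : V) {ω : BondConfig V} (hω : rcMass u q ω ≠ 0) :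
    ind (sepEv x c) ω = ind (sepEv v c) ω := by
  have hsub : oneSet u ⊆ ω := fun f hf => (mem_of_rcMass_ne_zero u q hω).1 f hf
  have hR : (openGraph ω).Reachable x v := hxv.mono (openGraph_le hsub)
  by_cases h : ω ∈ sepEv x c
  · have h' : ω ∈ sepEv v c := fun hvc => h (hR.trans hvc)
    rw [ind_of_mem h, ind_of_mem h']
  · have h' : ω ∉ sepEv v c := fun hvc => h fun hxc => hvc (hR.symm.trans hxc)
    rw [ind_of_not_mem h, ind_of_not_mem h']

/-- Transport of `φ_u(C_x ∈ 𝒰 ∩ S ∩ {x ↮ c})` from `x` to a surely-joined `v`, for any fixed event `S`.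
[cite: Grimmett2006, §1.4 eq. (1.20) (p. 15)] -/
theorem real_clusterIn_inter_inter_sepEv_eq (u : Sym2 V → unitInterval) {q : ℝ} (hq : 0 < q) {x v : V}
    (hxv : (openGraph (oneSet u)).Reachable x v) (𝒰 : Set (Set V)) (S : Set (BondConfig V)) (c : V) :
    (rcMeasureW u q ∅).real (clusterIn x 𝒰 ∩ S ∩ sepEv x c) = (rcMeasureW u q ∅).real (clusterIn v 𝒰 ∩ S ∩ sepEv v c) := by
  rw [real_eq_rcE_ind u hq, real_eq_rcE_ind u hq]
  refine rcE_congr_support u q fun ω hω => ?_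
  rw [ind_inter, ind_inter, ind_inter, ind_inter, ind_clusterIn_eq_of_oneSet_reachable u q hxv 𝒰 hω,
    ind_sepEv_eq_of_oneSet_reachable u q hxv c hω]

/-- Transport of `φ_u(S ∩ {x ↮ c})`. [cite: Grimmett2006, §1.4 eq. (1.20) (p. 15)] -/
theorem real_inter_sepEv_eq (u : Sym2 V → unitInterval) {q : ℝ} (hq : 0 < q) {x v : V}
    (hxv : (openGraph (oneSet u)).Reachable x v) (S : Set (BondConfig V)) (c : V) :
    (rcMeasureW u q ∅).real (S ∩ sepEv x c) = (rcMeasureW u q ∅).real (S ∩ sepEv v c) := by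
  rw [real_eq_rcE_ind u hq, real_eq_rcE_ind u hq]
  refine rcE_congr_support u q fun ω hω => ?_
  rw [ind_inter, ind_inter, ind_sepEv_eq_of_oneSet_reachable u q hxv c hω]

/-- **An event that is constant on the support factors out**: if `1_E = κ` on the support of `φ_w` then `φ_w(E ∩ S) = κ·φ_w(S)`.
[cite: Grimmett2006, §1.4 eq. (1.20) (p. 15)] -/
theorem real_inter_eq_const_mul (w : Sym2 V → unitInterval) {q : ℝ} (hq : 0 < q) {E : Set (BondConfig V)} {κ : ℝ}
    (hE : ∀ ω, rcMass w q ω ≠ 0 → ind E ω = κ) (S : Set (BondConfig V)) :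
    (rcMeasureW w q ∅).real (E ∩ S) = κ * (rcMeasureW w q ∅).real S := by
  rw [real_eq_rcE_ind w hq, real_eq_rcE_ind w hq]
  unfold rcE
  rw [Finset.mul_sum]
  refine Finset.sum_congr rfl fun ω _ => ?_
  by_cases hω : rcMass w q ω = 0
  · rw [hω]; ring
  · rw [ind_inter, hE ω hω]; ring

/-- In the deterministic case the indicator of `{C_x ∈ 𝒰} ∩ {x ↮ c}` is constant on the support.
[cite: Grimmett2006, §1.4 eq. (1.20) (p. 15)] -/
theorem ind_clusterIn_inter_sepEv_const (w : Sym2 V → unitInterval) (q : ℝ) (x c : V)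
    (hA : ∀ f ∈ cut {x} (oneSet w), w f = 0 ∨ w f = 1) (𝒰 : Set (Set V)) {ω : BondConfig V} (hω : rcMass w q ω ≠ 0) :
    ind (clusterIn x 𝒰 ∩ sepEv x c) ω = ind (clusterIn x 𝒰 ∩ sepEv x c) (oneSet w) := by
  have hR := reachY_iff_of_support w q {x} hA hω
  have hz : ∀ z, (openGraph ω).Reachable x z ↔ (openGraph (oneSet w)).Reachable x z := fun z => by
    have h := hR z; simp only [mem_singleton_iff, exists_eq_left] at h; exact h
  have hC : openCluster ω x = openCluster (oneSet w) x := by ext z; exact hz z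
  have hmem : ω ∈ clusterIn x 𝒰 ∩ sepEv x c ↔ oneSet w ∈ clusterIn x 𝒰 ∩ sepEv x c := by
    change openCluster ω x ∈ 𝒰 ∧ ¬ (openGraph ω).Reachable x c ↔ openCluster (oneSet w) x ∈ 𝒰 ∧ ¬ (openGraph (oneSet w)).Reachable x c
    rw [hC, hz c]
  by_cases h : ω ∈ clusterIn x 𝒰 ∩ sepEv x c
  · rw [ind_of_mem h, ind_of_mem (hmem.1 h)]
  · rw [ind_of_not_mem h, ind_of_not_mem (fun h' => h (hmem.2 h'))]

omit [Fintype V] in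
/-- `{C_x ∈ univ-family} = everything`: `clusterIn x univ = univ`. [folklore] -/
theorem clusterIn_univ (x : V) : clusterIn x (Set.univ : Set (Set V)) = Set.univ := by
  ext ω; simp [clusterIn]

end FK

end Summit.CriticalPhenomena.PercolationContinuityZ3.Theorems

end
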